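import Summits.BirchSwinnertonDyer.Rank1Residual.X2.IsogenyLambdaInvariant
import Summits.BirchSwinnertonDyer.Rank1Residual.X1.MuPart
import Literature.NumberTheory.EllipticCurves.IwasawaAlgebraStructureProofs
import Literature.NumberTheory.EllipticCurves.IwasawaAlgebraCharIdealProofs
import Literature.NumberTheory.EllipticCurves.IwasawaAlgebraMuAdditiveProofs
import Literature.NumberTheory.EllipticCurves.IwasawaAlgebraProofs
import Literature.NumberTheory.EllipticCurves.IwasawaSelmerDualUniquenessProofs
import Literature.NumberTheory.EllipticCurves.IwasawaSelmerModuleFiniteProofs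
import HarnessLib

/-!
# The characteristic ideal of `X(E/K_∞)` along an isogeny: `char X' · (p^{μ(X)}) = char X · (p^{μ(X')})`
# (route ByReductionTypeAtTwo, crux `OrdKatoHalfAtTwo` = item stmt-BirchSwinnertonDyer-19271; seat
# bsd-2adic-ord GEN 7; file 1 of 2 — the prime-free algebra, any `p`, any number field)

HONEST FRAMING (cell `bsd-2adic`, HUMAN RULINGS D-0036/D-0074): THEOREMS ONLY — no definition, no named
fact, nothing asserted, closes nothing. This file is the algebraic half of the seat's answer to the
planner's typed target ISO-μ@2 ("the isogeny formula for the `μ`-invariant at `p = 2`", Greenberg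
LNM 1716 p. 64: in print only for odd `p`, Schneider 1987 / Perrin-Riou): everything here holds for
every prime `p` and every `ℤ_p`-extension, and says how far the characteristic ideal of the Selmer dual
can move inside an isogeny class.

* §1 (pure `Λ = ℤ_p⟦T⟧`-algebra). `charIdeal_eq_span_C_pow_muInvariant_of_nsmul_eq_zero`: a finitely
  generated `Λ`-module killed by a non-zero integer `n` is torsion with `char = (p^{μ})` (structure
  theorem + `λ = dim_{ℚ_p}(ℚ_p ⊗ M) = 0`; all inputs are the tree's DISCHARGED facts
  `exists_isPseudoIsomorphism_elementary_holds`, `charIdeal_eq_span_holds`, `muInvariant_eq_sum_holds`,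
  `lambdaInvariant_eq_sum_natDegree_holds`). **`charIdeal_mul_span_eq_of_quasiInverse`**: for f.g.
  torsion `X, X'` and `Λ`-linear `F : X' → X`, `G : X → X'` with `F ∘ G = n = G ∘ F`, `n ≠ 0`:
  `char X' · (p^{μ(X)}) = char X · (p^{μ(X')})` (two short exact sequences, `ker F` and `coker F`
  killed by `n`; `charIdeal_mul_of_shortExact_holds`, `muInvariant_add_of_shortExact_holds`).
* §2 (Selmer duals). `dualMap_smul`: the dual `α^∨ : X(E'/K_∞) → X(E/K_∞)` of a `conj_γ`-equivariant
  additive map `α` of Selmer groups (`X2.IsogenyLambdaInvariant.dualMap`, proved `ℤ_p`-linear there) is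
  `Λ`-LINEAR — the forced-action induction of `IwasawaSelmerDualUniquenessProofs` run for two curves.
  **`SelmerDualData.charIdeal_mul_span_eq_of_isogeny`**: for a `K`-isogeny `φ : E → E'`, a
  topological generator `γ` and dual data `D, D'` with `D.X` torsion:
  `D'.charIdeal · (p^{D.mu}) = D.charIdeal · (p^{D'.mu})` and `D'` is torsion — Greenberg's "the
  characteristic ideals differ only by multiplication by a power of `p`" (LNM 1716 p. 64) with the
  power IDENTIFIED as `μ(X') − μ(X)`; hence (`…valuation_constantCoeff_add_mu_eq_of_isIsogenous`) for
  generators `f, f'` with `f(0) ≠ 0`: `ord_p f'(0) + μ(E) = ord_p f(0) + μ(E')` — the valuation of the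
  constant term of the DISTINGUISHED part of a characteristic power series is an isogeny invariant,
  the `μ`-invariant alone is not (Greenberg Prop. 5.13).

What this is NOT: not the isogeny formula itself (which `μ(X') − μ(X)` occurs is arithmetic: file 2,
`ByReductionTypeAtTwoOrdKatoHalfIsogeny.lean`, pins it at analytic rank `0`, `p = 2`, by Greenberg's
Thm. 4.1 and Cassels); no statement about `λ` beyond the tree's `X2.IsogenyLambdaInvariant`.

References: R. Greenberg, LNM 1716 (1999), §1 p. 64 and Props. 5.13–5.14; R. Greenberg, V. Vatsal,
Invent. Math. 142 (2000), §2 p. 28; L. Washington, *Introduction to Cyclotomic Fields*, §13.2;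
P. Schneider, J. Indian Math. Soc. 52 (1987) (odd `p`).
-/

set_option autoImplicit false

noncomputable section

open scoped Classical TensorProduct

universe u

open WeierstrassCurve Literature.NumberTheory.EllipticCurves Field IsDedekindDomain NumberField
  Summit.BirchSwinnertonDyer.Rank1Residual.X2.IsogenySelmerInfty
  Summit.BirchSwinnertonDyer.Rank1Residual.X2.IsogenyLambdaInvariant

namespace Summit.BirchSwinnertonDyer.BirchSwinnertonDyer.Theorems.KatoHalfIsogeny

/-! ## §1. `Λ`-algebra: the characteristic ideal along a pair of quasi-inverse maps -/

section Algebra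

variable (p : ℕ) [Fact p.Prime]

/-- A natural number `n ≠ 0` is a non-zero element of `Λ = ℤ_p⟦T⟧`. [folklore] -/
theorem natCast_ne_zero {n : ℕ} (hn : n ≠ 0) : (n : IwasawaAlgebra p) ≠ 0 := by
  rw [← map_natCast (PowerSeries.C (R := ℤ_[p])) n]
  intro h
  have h' : ((n : ℕ) : ℤ_[p]) = 0 := PowerSeries.C_injective (h.trans (map_zero _).symm)
  exact hn (by exact_mod_cast h')

/-- A `Λ`-module killed by a non-zero integer is a torsion `Λ`-module. [folklore] -/
theorem isTorsion_of_nsmul_eq_zero {M : Type*} [AddCommGroup M] [Module (IwasawaAlgebra p) M]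
    {n : ℕ} (hn : n ≠ 0) (h : ∀ x : M, n • x = 0) : Module.IsTorsion (IwasawaAlgebra p) M := by
  intro x
  refine ⟨⟨(n : IwasawaAlgebra p), mem_nonZeroDivisors_of_ne_zero (natCast_ne_zero p hn)⟩, ?_⟩
  change (n : IwasawaAlgebra p) • x = 0
  rw [Nat.cast_smul_eq_nsmul]
  exact h x

/-- A `Λ`-module killed by a non-zero integer has `λ = dim_{ℚ_p}(ℚ_p ⊗_{ℤ_p} M) = 0`.
[cite: Washington1997, §13.2] -/
theorem lambdaInvariant_eq_zero_of_nsmul_eq_zero {M : Type*} [AddCommGroup M]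
    [Module (IwasawaAlgebra p) M] {n : ℕ} (hn : n ≠ 0) (h : ∀ x : M, n • x = 0) :
    lambdaInvariant p M = 0 := by
  have hunit : IsUnit (algebraMap ℤ_[p] ℚ_[p] (n : ℤ_[p])) := by
    rw [map_natCast, isUnit_iff_ne_zero]
    exact_mod_cast hn
  letI : Module ℤ_[p] M := Module.compHom M (algebraMap ℤ_[p] (IwasawaAlgebra p))
  haveI : Subsingleton (ℚ_[p] ⊗[ℤ_[p]] M) := by
    refine subsingleton_of_forall_eq 0 fun z => ?_
    induction z using TensorProduct.induction_on with
    | zero => rfl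
    | tmul c x =>
      refine Module.tmul_eq_zero_of_pow_smul_eq_zero ℚ_[p] hunit (n := 1) ?_ c
      change (algebraMap ℤ_[p] (IwasawaAlgebra p) ((n : ℤ_[p]) ^ 1)) • x = 0
      rw [pow_one, map_natCast, Nat.cast_smul_eq_nsmul]
      exact h x
    | add x y hx hy => rw [hx, hy, add_zero]
  change Module.finrank ℚ_[p] (ℚ_[p] ⊗[ℤ_[p]] M) = 0
  exact Module.finrank_zero_of_subsingleton

/-- **A finitely generated `Λ`-module killed by a non-zero integer has characteristic ideal
`(p^{μ})`.** Structure theorem (`M ∼ ⨁ Λ/(p^{μᵢ}) ⊕ ⨁ Λ/(fⱼ^{nⱼ})`, `fⱼ` distinguished irreducible,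
`nⱼ ≥ 1`): `λ(M) = ∑ nⱼ deg fⱼ = 0` forces no `fⱼ`, so `char M = (p^{∑ μᵢ}) = (p^{μ(M)})`.
[cite: Washington1997, Thm. 13.12 and §13.2] -/
theorem charIdeal_eq_span_C_pow_muInvariant_of_nsmul_eq_zero {M : Type*} [AddCommGroup M]
    [Module (IwasawaAlgebra p) M] [Module.Finite (IwasawaAlgebra p) M] {n : ℕ} (hn : n ≠ 0)
    (h : ∀ x : M, n • x = 0) :
    Literature.NumberTheory.EllipticCurves.Module.charIdeal (IwasawaAlgebra p) M =
      Ideal.span {PowerSeries.C ((p : ℤ_[p]) ^ muInvariant p M)} := by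
  have hM := isTorsion_of_nsmul_eq_zero p hn h
  obtain ⟨μs, fs, -, hfs, hψ⟩ := exists_isPseudoIsomorphism_elementary_holds p M hM
  have hfs' : ∀ f ∈ fs, f.1.IsDistinguishedAt (IsLocalRing.maximalIdeal ℤ_[p]) :=
    fun f hf ↦ (hfs f hf).1
  have hlam : (fs.map fun f => f.2 * f.1.natDegree).sum = 0 :=
    (lambdaInvariant_eq_sum_natDegree_holds p M hfs' hψ).symm.trans
      (lambdaInvariant_eq_zero_of_nsmul_eq_zero p hn h)
  have hnil : fs = [] := by
    rw [List.eq_nil_iff_forall_not_mem]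
    intro f hf
    have h0 : f.2 * f.1.natDegree = 0 :=
      List.sum_eq_zero_iff.mp hlam _ (List.mem_map.mpr ⟨f, hf, rfl⟩)
    obtain ⟨hdist, hirr, hpos⟩ := hfs f hf
    rcases Nat.mul_eq_zero.mp h0 with h2 | hdeg
    · omega
    · have h1 : f.1 = 1 := (Polynomial.Monic.natDegree_eq_zero hdist.monic).mp hdeg
      exact hirr.not_isUnit (h1 ▸ isUnit_one)
  subst hnil
  rw [charIdeal_eq_span_holds p M hfs' hψ, muInvariant_eq_sum_holds p M hfs' hψ]
  simp [charElement]

/-- **The characteristic ideal along a pair of quasi-inverse maps.** Let `X, X'` be finitely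
generated torsion `Λ`-modules and `F : X' → X`, `G : X → X'` `Λ`-linear with `F ∘ G = n` and
`G ∘ F = n` for an integer `n ≠ 0` (e.g. the duals of `Sel(φ)`, `Sel(φ̂)` for an isogeny `φ` of
degree `n`). Then `char X' · (p^{μ(X)}) = char X · (p^{μ(X')})`: with `K = ker F`, `I = im F`,
`C = coker F` one has `char X' = char K · char I`, `char X = char I · char C`,
`μ(X') = μ(K) + μ(I)`, `μ(X) = μ(I) + μ(C)`, and `K`, `C` are killed by `n`, so
`char K = (p^{μ(K)})`, `char C = (p^{μ(C)})`. This is Greenberg's remark that the characteristic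
ideals of isogenous curves "differ only by multiplication by a power of `p`" (LNM 1716, p. 64) with
the power identified. [cite: GreenbergLNM1716, §1 p. 64] [cite: Washington1997, §13.2] -/
theorem charIdeal_mul_span_eq_of_quasiInverse {X X' : Type*} [AddCommGroup X]
    [Module (IwasawaAlgebra p) X] [AddCommGroup X'] [Module (IwasawaAlgebra p) X']
    [Module.Finite (IwasawaAlgebra p) X] [Module.Finite (IwasawaAlgebra p) X']
    (hX : Module.IsTorsion (IwasawaAlgebra p) X) (hX' : Module.IsTorsion (IwasawaAlgebra p) X')
    (F : X' →ₗ[IwasawaAlgebra p] X) (G : X →ₗ[IwasawaAlgebra p] X') {n : ℕ} (hn : n ≠ 0)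
    (hFG : ∀ x, F (G x) = n • x) (hGF : ∀ x', G (F x') = n • x') :
    Literature.NumberTheory.EllipticCurves.Module.charIdeal (IwasawaAlgebra p) X' *
        Ideal.span {PowerSeries.C ((p : ℤ_[p]) ^ muInvariant p X)} =
      Literature.NumberTheory.EllipticCurves.Module.charIdeal (IwasawaAlgebra p) X *
        Ideal.span {PowerSeries.C ((p : ℤ_[p]) ^ muInvariant p X')} := by
  haveI : IsNoetherian (IwasawaAlgebra p) X := isNoetherian_of_isNoetherianRing_of_finite _ _
  haveI : IsNoetherian (IwasawaAlgebra p) X' := isNoetherian_of_isNoetherianRing_of_finite _ _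
  set K : Submodule (IwasawaAlgebra p) X' := LinearMap.ker F with hK
  set I : Submodule (IwasawaAlgebra p) X := LinearMap.range F with hI
  -- the two short exact sequences
  have hex₁ : Function.Exact K.subtype F.rangeRestrict := by
    rw [LinearMap.exact_iff, LinearMap.ker_rangeRestrict, Submodule.range_subtype]
  have hex₂ : Function.Exact I.subtype I.mkQ := LinearMap.exact_subtype_mkQ I
  have hc₁ := charIdeal_mul_of_shortExact_holds p X' hX' K.subtype F.rangeRestrict
    (Submodule.subtype_injective K) (LinearMap.surjective_rangeRestrict F) hex₁
  have hμ₁ := muInvariant_add_of_shortExact_holds p X' hX' K.subtype F.rangeRestrict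
    (Submodule.subtype_injective K) (LinearMap.surjective_rangeRestrict F) hex₁
  have hc₂ := charIdeal_mul_of_shortExact_holds p X hX I.subtype I.mkQ
    (Submodule.subtype_injective I) (Submodule.mkQ_surjective I) hex₂
  have hμ₂ := muInvariant_add_of_shortExact_holds p X hX I.subtype I.mkQ
    (Submodule.subtype_injective I) (Submodule.mkQ_surjective I) hex₂
  -- `ker F` and `coker F` are killed by `n`
  have hKn : ∀ x : K, n • x = 0 := by
    intro x
    apply Subtype.ext
    rw [AddSubmonoidClass.coe_nsmul, ZeroMemClass.coe_zero, ← hGF, LinearMap.mem_ker.mp x.2,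
      map_zero]
  have hCn : ∀ y : X ⧸ I, n • y = 0 := by
    intro y
    obtain ⟨x, rfl⟩ := Submodule.mkQ_surjective I y
    rw [← map_nsmul, ← hFG, Submodule.mkQ_apply, Submodule.Quotient.mk_eq_zero]
    exact LinearMap.mem_range_self F (G x)
  rw [hc₁, hc₂, hμ₁, hμ₂, charIdeal_eq_span_C_pow_muInvariant_of_nsmul_eq_zero p hn hKn,
    charIdeal_eq_span_C_pow_muInvariant_of_nsmul_eq_zero p hn hCn, pow_add, pow_add, map_mul,
    map_mul, ← Ideal.span_singleton_mul_span_singleton, ← Ideal.span_singleton_mul_span_singleton]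
  ring

/-- The `p`-adic valuation of a unit of `ℤ_p` is `0`. [folklore] -/
theorem valuation_units_eq_zero (u : ℤ_[p]ˣ) : ((u : ℤ_[p])).valuation = 0 := by
  have h := PadicInt.valuation_mul u.ne_zero u⁻¹.ne_zero
  rw [Units.mul_inv, PadicInt.valuation_one] at h
  omega

end Algebra

/-! ## §2. Selmer duals: `Λ`-linearity of dual maps and the isogeny identity -/

section Dual

variable {K : Type u} [Field K] [NumberField K] {W W' : WeierstrassCurve K} {p : ℕ} [Fact p.Prime]
  {κ : ZpExtension K p} {γ : absoluteGaloisGroup K}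
  (D : W.SelmerDualData κ γ) (D' : W'.SelmerDualData κ γ)

/-- **Peeling off the constant term.** For a dual datum `D`, `f ∈ Λ`, `x ∈ X` and a class `s`
killed by `p^k`: `(f • x)(s) = (g • x)((conj_γ - 1) s) + (a₀ mod p^k) · x(s)` where
`f = T·g + C(a₀)` (`toDual_T_smul`, `toDual_C_smul`). [cite: GreenbergLNM1716, §1 (after Conj. 1.3)] -/
theorem toDual_smul_apply_peel {V : WeierstrassCurve K} (DV : V.SelmerDualData κ γ)
    (f : IwasawaAlgebra p) (x : DV.X) (s : V.selmerInfty κ) {k : ℕ} (hk : p ^ k • s = 0) :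
    DV.toDual (f • x) s =
      DV.toDual ((PowerSeries.mk fun m ↦ PowerSeries.coeff (m + 1) f) • x)
          ((V.conjSelmerInfty κ γ - 1) s) +
        (PadicInt.toZModPow k (PowerSeries.constantCoeff f)).val • DV.toDual x s := by
  set g : IwasawaAlgebra p := PowerSeries.mk fun m ↦ PowerSeries.coeff (m + 1) f
  set a : ℤ_[p] := PowerSeries.constantCoeff f
  have hf : f = PowerSeries.X * g + PowerSeries.C a := PowerSeries.eq_X_mul_shift_add_const f
  have hψeval : DV.toDual (g • x) ((V.conjSelmerInfty κ γ - 1) s) =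
      DV.toDual (g • x) ⟨V.conjH1 p κ.kerSubgroup γ s, DV.conj_mem s s.2⟩ - DV.toDual (g • x) s := by
    rw [IwasawaDual.End_sub_apply, AddMonoid.End.one_apply, map_sub]
    rfl
  conv_lhs => rw [hf]
  rw [add_smul, mul_smul, map_add, AddMonoidHom.add_apply, DV.toDual_T_smul,
    DV.toDual_C_smul a x s k hk, hψeval]

/-- Induction carrier for `dualMap_smul`: on classes `s ∈ Sel_{p^∞}(E/K_∞)` killed by `ψ^N`,
`ψ = conj_γ - 1`, the two ways of reading `f • α^∨(x')` through `toDual` agree, for a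
`conj_γ`-equivariant `α` (induction on `N`, `toDual_smul_apply_peel` on both curves).
[cite: GreenbergLNM1716, §1 (after Conj. 1.3)] -/
theorem toDual_dualMap_smul_apply_of_pow_apply_eq_zero (α : W.selmerInfty κ →+ W'.selmerInfty κ)
    (hα : ∀ s : W.selmerInfty κ, α (W.conjSelmerInfty κ γ s) = W'.conjSelmerInfty κ γ (α s))
    (N : ℕ) :
    ∀ (s : W.selmerInfty κ), ((W.conjSelmerInfty κ γ - 1) ^ N) s = 0 →
      ∀ (f : IwasawaAlgebra p) (x' : D'.X),
        D.toDual (dualMap D D' α (f • x')) s = D.toDual (f • dualMap D D' α x') s := by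
  induction N with
  | zero =>
    intro s hs f x'
    rw [pow_zero, AddMonoid.End.one_apply] at hs
    rw [hs, map_zero, map_zero]
  | succ N ih =>
    intro s hs f x'
    obtain ⟨k, hk⟩ := (W.isLocNil_conjSelmerInfty_sub_one' κ γ).torsion s
    have hkα : p ^ k • α s = 0 := by rw [← map_nsmul, hk, map_zero]
    have hψs : ((W.conjSelmerInfty κ γ - 1) ^ N) ((W.conjSelmerInfty κ γ - 1) s) = 0 := by
      rwa [pow_succ, AddMonoid.End.coe_mul, Function.comp_apply] at hs
    -- `α` intertwines `conj_γ - 1` on the two Selmer groups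
    have hαψ : α ((W.conjSelmerInfty κ γ - 1) s) = (W'.conjSelmerInfty κ γ - 1) (α s) := by
      rw [IwasawaDual.End_sub_apply, IwasawaDual.End_sub_apply, AddMonoid.End.one_apply,
        AddMonoid.End.one_apply, map_sub, hα]
    set g : IwasawaAlgebra p := PowerSeries.mk fun m ↦ PowerSeries.coeff (m + 1) f with hg
    -- the two peelings
    have lhs₁ := toDual_smul_apply_peel D' f x' (α s) hkα
    have rhs₁ := toDual_smul_apply_peel D f (dualMap D D' α x') s hk
    -- the three bridges through `toDual ∘ α^∨ = toDual' ∘ α`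
    have h₁ : D.toDual (dualMap D D' α (f • x')) s = D'.toDual (f • x') (α s) := by
      rw [toDual_dualMap, AddMonoidHom.comp_apply]
    have h₂ : D'.toDual (g • x') ((W'.conjSelmerInfty κ γ - 1) (α s)) =
        D.toDual (g • dualMap D D' α x') ((W.conjSelmerInfty κ γ - 1) s) := by
      rw [← ih _ hψs g x', toDual_dualMap, AddMonoidHom.comp_apply, hαψ]
    have h₃ : D'.toDual x' (α s) = D.toDual (dualMap D D' α x') s := by
      rw [toDual_dualMap, AddMonoidHom.comp_apply]
    rw [h₁, lhs₁, rhs₁, h₂, h₃]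

/-- **The dual of a `conj_γ`-equivariant map of Selmer groups is `Λ`-linear.** For an additive
`α : Sel_{p^∞}(E/K_∞) → Sel_{p^∞}(E'/K_∞)` commuting with `conj_γ` and Pontryagin-dual data `D, D'`:
`α^∨(f • x') = f • α^∨(x')` for all `f ∈ Λ` (every Selmer class is killed by a power of
`conj_γ - 1`, `isLocNil_conjSelmerInfty_sub_one'`). [cite: GreenbergLNM1716, §1 (after Conj. 1.3)] -/
theorem dualMap_smul (α : W.selmerInfty κ →+ W'.selmerInfty κ)
    (hα : ∀ s : W.selmerInfty κ, α (W.conjSelmerInfty κ γ s) = W'.conjSelmerInfty κ γ (α s))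
    (f : IwasawaAlgebra p) (x' : D'.X) :
    dualMap D D' α (f • x') = f • dualMap D D' α x' := by
  apply D.bijective.1
  ext s
  obtain ⟨N, hN⟩ := (W.isLocNil_conjSelmerInfty_sub_one' κ γ).nil s
  exact toDual_dualMap_smul_apply_of_pow_apply_eq_zero D D' α hα N s hN f x'

variable (κ) in
/-- `Sel(φ)` is `conj_γ`-equivariant, as an identity of Selmer classes
(`coe_isogenySelmerInftyMap_conjH1`). [folklore] -/
theorem isogenySelmerInftyMap_conjSelmerInfty [W.IsElliptic] [W'.IsElliptic] (φ : Isogeny W W')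
    (s : W.selmerInfty κ) :
    isogenySelmerInftyMap p κ φ (W.conjSelmerInfty κ γ s) =
      W'.conjSelmerInfty κ γ (isogenySelmerInftyMap p κ φ s) :=
  Subtype.ext (coe_isogenySelmerInftyMap_conjH1 p κ φ γ s _)

/-- **The characteristic ideal along an isogeny.** For a `K`-isogeny `φ : E → E'` of elliptic curves
over a number field, any `ℤ_p`-extension `κ` with topological generator `γ`, and Pontryagin-dual
data `D, D'` with `X(E/K_∞) = D.X` torsion: `X(E'/K_∞)` is torsion and
`char X(E'/K_∞) · (p^{μ(E)}) = char X(E/K_∞) · (p^{μ(E')})`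
(`charIdeal_mul_span_eq_of_quasiInverse` for the `Λ`-linear duals of `Sel(φ)`, `Sel(φ̂)`, whose
composites are `deg φ`). [cite: GreenbergLNM1716, §1 p. 64] [cite: GreenbergVatsal2000, §2 p. 28] -/
theorem _root_.WeierstrassCurve.SelmerDualData.isTorsion_and_charIdeal_mul_span_eq_of_isogeny
    [W.IsElliptic] [W'.IsElliptic] (φ : Isogeny W W') (hγ : κ.IsTopGenerator γ)
    (hX : D.IsTorsion) :
    D'.IsTorsion ∧
      D'.charIdeal * Ideal.span {PowerSeries.C ((p : ℤ_[p]) ^ D.mu)} =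
        D.charIdeal * Ideal.span {PowerSeries.C ((p : ℤ_[p]) ^ D'.mu)} := by
  haveI : Module.Finite (IwasawaAlgebra p) D.X := D.module_finite_holds hγ
  haveI : Module.Finite (IwasawaAlgebra p) D'.X := D'.module_finite_holds hγ
  obtain ⟨ψ, hψ⟩ := φ.exists_dual_of_isElliptic
  set n : ℕ := φ.degree with hn
  have hn0 : n ≠ 0 := φ.degree_pos.ne'
  have hφψ : ∀ Q : W'.geomPoints, φ (ψ Q) = (n : ℤ) • Q := by
    intro Q
    obtain ⟨P, rfl⟩ := φ.surjective Q
    rw [hψ, map_zsmul]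
  set α := isogenySelmerInftyMap p κ φ with hα
  set β := isogenySelmerInftyMap p κ ψ with hβ
  have hβα : ∀ s, β (α s) = n • s := fun s ↦ isogenySelmerInftyMap_comp_apply p κ φ ψ hψ s
  have hαβ : ∀ s, α (β s) = n • s := fun s ↦ isogenySelmerInftyMap_comp_apply p κ ψ φ hφψ s
  -- the `Λ`-linear duals `F = α^∨ : X' → X`, `G = β^∨ : X → X'`
  let F : D'.X →ₗ[IwasawaAlgebra p] D.X :=
    { toFun := dualMap D D' α
      map_add' := (dualMap D D' α).map_add
      map_smul' := fun c x' ↦ dualMap_smul D D' α (isogenySelmerInftyMap_conjSelmerInfty κ φ) c x' }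
  let G : D.X →ₗ[IwasawaAlgebra p] D'.X :=
    { toFun := dualMap D' D β
      map_add' := (dualMap D' D β).map_add
      map_smul' := fun c x ↦ dualMap_smul D' D β (isogenySelmerInftyMap_conjSelmerInfty κ ψ) c x }
  have hFG : ∀ x, F (G x) = n • x := fun x ↦ dualMap_dualMap_of_comp_eq_nsmul D D' α β hβα x
  have hGF : ∀ x', G (F x') = n • x' := fun x' ↦ dualMap_dualMap_of_comp_eq_nsmul D' D β α hαβ x'
  -- `X'` is torsion: `x'` is killed by `n · a` whenever `a` kills `F x'`
  have hX' : D'.IsTorsion := by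
    intro x'
    obtain ⟨⟨a, ha⟩, hax⟩ := @hX (F x')
    refine ⟨⟨(n : IwasawaAlgebra p) * a, mul_mem (mem_nonZeroDivisors_of_ne_zero
      (natCast_ne_zero p hn0)) ha⟩, ?_⟩
    change ((n : IwasawaAlgebra p) * a) • x' = 0
    have hax' : a • F x' = 0 := hax
    rw [mul_comm, mul_smul, Nat.cast_smul_eq_nsmul, ← hGF, ← map_smul, hax', map_zero]
  exact ⟨hX', charIdeal_mul_span_eq_of_quasiInverse p hX hX' F G hn0 hFG hGF⟩

/-- `IsIsogenous` form: some power-of-`p` balance `char X' · (p^{μ}) = char X · (p^{μ'})` for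
`K`-isogenous curves. [cite: GreenbergLNM1716, §1 p. 64] -/
theorem _root_.WeierstrassCurve.SelmerDualData.isTorsion_and_charIdeal_mul_span_eq_of_isIsogenous
    [W.IsElliptic] [W'.IsElliptic] (h : IsIsogenous W W') (hγ : κ.IsTopGenerator γ)
    (hX : D.IsTorsion) :
    D'.IsTorsion ∧
      D'.charIdeal * Ideal.span {PowerSeries.C ((p : ℤ_[p]) ^ D.mu)} =
        D.charIdeal * Ideal.span {PowerSeries.C ((p : ℤ_[p]) ^ D'.mu)} :=
  h.elim fun φ ↦ D.isTorsion_and_charIdeal_mul_span_eq_of_isogeny D' φ hγ hX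

/-- **The constant-term / `μ` balance along an isogeny.** For `K`-isogenous `E ∼ E'`, a topological
generator `γ`, dual data `D, D'` with `X(E/K_∞)` torsion, and generators `char X(E/K_∞) = (f)`,
`char X(E'/K_∞) = (f')` with `f(0) ≠ 0`: `f'(0) ≠ 0` and
`ord_p f'(0) + μ(E) = ord_p f(0) + μ(E')`. [cite: GreenbergLNM1716, §1 p. 64] -/
theorem _root_.WeierstrassCurve.SelmerDualData.valuation_constantCoeff_add_mu_eq_of_isIsogenous
    [W.IsElliptic] [W'.IsElliptic] (h : IsIsogenous W W') (hγ : κ.IsTopGenerator γ)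
    (hX : D.IsTorsion) {f f' : IwasawaAlgebra p} (hf : D.charIdeal = Ideal.span {f})
    (hf' : D'.charIdeal = Ideal.span {f'}) (h0 : PowerSeries.constantCoeff f ≠ 0) :
    PowerSeries.constantCoeff f' ≠ 0 ∧
      (PowerSeries.constantCoeff f').valuation + D.mu =
        (PowerSeries.constantCoeff f).valuation + D'.mu := by
  obtain ⟨hX', key⟩ := D.isTorsion_and_charIdeal_mul_span_eq_of_isIsogenous D' h hγ hX
  rw [hf, hf', Ideal.span_singleton_mul_span_singleton, Ideal.span_singleton_mul_span_singleton,
    Ideal.span_singleton_eq_span_singleton] at key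
  obtain ⟨u, hu⟩ := key
  have hcc := congrArg PowerSeries.constantCoeff hu
  simp only [map_mul, PowerSeries.constantCoeff_C] at hcc
  have hp0 : ∀ m : ℕ, ((p : ℤ_[p]) ^ m) ≠ 0 := fun m => pow_ne_zero _ (NeZero.ne _)
  have hu0 : PowerSeries.constantCoeff (↑u : IwasawaAlgebra p) ≠ 0 :=
    (u.isUnit.map PowerSeries.constantCoeff).ne_zero
  have hf'0 : PowerSeries.constantCoeff f' ≠ 0 := by
    intro h
    rw [h, zero_mul, zero_mul] at hcc
    exact mul_ne_zero h0 (hp0 _) hcc.symm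
  refine ⟨hf'0, ?_⟩
  obtain ⟨v, hv⟩ := u.isUnit.map PowerSeries.constantCoeff
  have hval := congrArg PadicInt.valuation hcc
  rw [PadicInt.valuation_mul (mul_ne_zero hf'0 (hp0 _)) hu0, PadicInt.valuation_mul hf'0 (hp0 _),
    PadicInt.valuation_mul h0 (hp0 _), PadicInt.valuation_pow, PadicInt.valuation_pow,
    PadicInt.valuation_p, ← hv, valuation_units_eq_zero] at hval
  omega

end Dual

end Summit.BirchSwinnertonDyer.BirchSwinnertonDyer.Theorems.KatoHalfIsogeny

end
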